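/-
Copyright (c) 2026 the pub-hodgecm-mathlib formalisation cell (harness21).  Prover seat hodgecm-mathlib-K2E3-p06 (g5), Track B «K2-LIT», engine E3, unit U4 «Keys»; deal (D61)
LINE LEAD of the open leaf (U4f-χ₁-ram-one), design D-I, plan DESIGN-B v1 step (B5) «THE WEIGHT SHELL INTEGRALS DILATE BY `χ₁(ϖσϖ)`» on `N(L⁺_v) ≤ U(Φ₃)(L⁺_v)`;
2026-09-04.  KERNEL module: THEOREMS ONLY (no definition, no named fact, no `sorry`, no instance, no notation).
-/
import Summits.HodgeConjecture.HodgeConjecture.Theorems.K2E3HeightBallVolumeScaling           -- ★ (K2E3-p04): brings ★ `height_torusConj`, ★ `map_torusConj_cmBorel_eq_modularCharacter_nnreal_smul`, ★ `modularCharacter_cmBorel_torus`, ★ `torusChart`, ★ DICT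
import Summits.HodgeConjecture.HodgeConjecture.Theorems.F0P3cStCharTSKeys3TorusConjBall       -- ★ (LH4): `entry_torusConj` (`(t⁻¹ u t)ᵢⱼ = dᵢ⁻¹ uᵢⱼ dⱼ`)
import Summits.HodgeConjecture.HodgeConjecture.Theorems.F0P3cStCharTSBigCellFactorisation     -- ★ (LH4): `neg_one_mem_normOneUnits` (the letter `χ₂(−1)` of the weight)
import HarnessLib

/-!
# K2 ∕ E3 «EllipticInputs», unit U4 «Keys» — (U4f-χ₁-ram-one) step (B5) of DESIGN-B: TORUS DILATION OF THE WEIGHT INTEGRALS ON `N(L⁺_v)`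
# «`∫_{S_{j+2}} c dμ = χ₁(α·σα) · ∫_{S_j} c dμ`», `c(u) = χ₁(σ u₀₂)⁻¹ χ₂(−1) ‖u₀₂‖⁻¹`, `S_j = {m = ‖α‖^{-j}}` — for ANY `χ₁, χ₂` (no continuity) and any unit `α`
# [Casselman1995 §6.4 p. 63; Keys1984 §3–§4; WeilBNT1967 Ch. II §5 Prop. 12; Rogawski1990 §1.10]

Cell hodgecm-mathlib (D-0151), FLOOR 0, Track B «K2-LIT», engine E3, crux item H413 = stmt-HodgeConjecture-24833 (route `HCCMUnconditional`, no route verbs); target BY NAME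
the OPEN leaf `…K2E3EllipticInputs.U4Keys.sig_K2E3KeysThmTwoContractingRamifiedCharOne` (U4Keys ED. 7; cand v5 leaf (U4f-χ₁-ram-one-d0B)), design D-I, plan `DESIGN-B-v1`
(`K2/K2E3-p06/g5/DESIGN-B-v1-BranchBDepthZero.K2E3-p06-g5.md`) step (B5).  Author K2E3-p06 (g5), line lead (D61).  `--supports stmt-HodgeConjecture-24833 --as helper`; THEOREMS ONLY.
NOT THE PAYER: with ★ (B4) (`G₁G₂ = μ(B₀)μ(B_{-1})`, `G₁ = ∫_{m>1} c`, `G₂ = ∫_{m≥1} c`) this reduces Branch B to the two BASE SHELLS `T_0 = ∫_{S_0} c`, `T_1 = ∫_{S_1} c` (steps (B6)–(B7)).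

THE MATHEMATICS.  `R = L ⊗ L⁺_v`, `σ = c ⊗ 1`, `‖·‖ = unitModulusChar R`, `N = N(L⁺_v)` with Haar measure `μ`, height `m(u) = Π_{w′}|(u₀₂)_{w′}|` (`= ‖u₀₂‖` on units), the WEIGHT
`c(u) := χ₁(σ b)⁻¹ · χ₂(−1) · ‖b‖⁻¹` if `b = u₀₂` is a unit, `0` otherwise (the far-out cell value of ★ `toFun_weylElt_mul_eq_of_isUnit`; `χ₁, χ₂` ARBITRARY homomorphisms —
no continuity, no ramification hypothesis).  For a unit `α` let `t = d(α, 1·, σα⁻¹)` (★ `torusChart (α, 1)`) and `T = torusConj t : u ↦ t⁻¹ u t` (★ `HeisRing.torusConj`).  Then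
`(Tu)₀₂ = α⁻¹ u₀₂ (σα)⁻¹` (★ `entry_torusConj`), so `m(Tu) = ‖α‖⁻² m(u)` (★ `height_torusConj`) and **`c(Tu) = χ₁(α σα) ‖α‖² c(u)`** (§2); and `μ.map T = ‖α‖² • μ` (★
`map_torusConj_cmBorel_eq_modularCharacter_nnreal_smul` + ★ `modularCharacter_cmBorel_torus`), i.e. **`∫ F(Tu) dμ = ‖α‖² ∫ F dμ` for EVERY `F : N → ℂ`** (§1; `T` is a
homeomorphism, so Mathlib `MeasurableEmbedding.integral_map` needs no measurability of `F`).  Since `T⁻¹(S_{j+2}) = S_j` for the shells `S_j = {m = (‖α‖⁻¹)^j}`: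
* §3 **`setIntegral_weight_shell_succ_succ`**: **`∫_{S_{j+2}} c dμ = χ₁(α·σα) · ∫_{S_j} c dμ`** — the `2`-step recursion `T_{j+2} = ρ T_j`, `ρ = χ₁(α σα)`, of DESIGN-B (B5);
  for `α = ϖ` a uniformiser and `|χ₁| = ‖·‖^s` one has `|ρ| = ‖ϖ‖^{2s} < 1`.  (The spherical case ★ `measure_shell_succ_succ` is `χ₁` unramified, `c` constant on shells.)
HONEST LABEL: HC_CM is proved only modulo the 7 printed citations (2 remaining named inputs: hLiu418 = stmt-HodgeConjecture-24832, h413 = stmt-HodgeConjecture-24833)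
until rung 0 closes; count-neutral — this file does NOT pay the leaf; no printed citation is discharged.

## References
* [Casselman1995] W. Casselman, *Introduction to the theory of admissible representations of `p`-adic reductive groups* (1995), §6.4 p. 63 (the integral shell by shell).
* [Keys1984] D. Keys, *Principal series representations of special unitary groups over local fields*, Compositio Math. 51 (1984), §3–§4 (the rank-one computation).
* [WeilBNT1967] A. Weil, *Basic Number Theory* (1967), Ch. II §5 Prop. 12 (modulus of an automorphism).
* [Rogawski1990] J. D. Rogawski, *Automorphic Representations of Unitary Groups in Three Variables* (1990), §1.10 p. 9, §4.5 p. 45.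
-/

set_option autoImplicit false
-- the mandated namespace has the single-problem summit's repeated segment (`HodgeConjecture.HodgeConjecture`)
set_option linter.dupNamespace false

noncomputable section

open NumberField IsDedekindDomain MeasureTheory
open scoped Matrix MatrixGroups WithZero Valued NNReal ENNReal
open Literature.NumberTheory Literature.NumberTheory.Automorphic Literature.NumberTheory.Automorphic.UnitaryGroup
open Literature.NumberTheory.Rogawski1990 Literature.NumberTheory.GaloisRepresentations Literature.NumberTheory.GaloisRepresentations.IsNonarchimedeanLocalField

namespace Summit.HodgeConjecture.HodgeConjecture.Cruxes.H413.K2E3WeightShellDilation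

open Summit.HodgeConjecture.HodgeConjecture.Cruxes.H413

variable (L : Type) [Field L] [NumberField L] [IsCMField L] (v : HeightOneSpectrum (𝓞 ↥(maximalRealSubfield L)))
  [MeasurableSpace ↥(cmBorelTriple L 3 v).N] [BorelSpace ↥(cmBorelTriple L 3 v).N] (μ : Measure ↥(cmBorelTriple L 3 v).N) [μ.IsHaarMeasure]

/-! ## §1 Change of variables under torus conjugation: `∫ F(t⁻¹ u t) dμ = ‖α‖² ∫ F dμ` -/

/-- **`∫_N F(t⁻¹ u t) dμ(u) = ‖α‖·‖α‖ · ∫_N F dμ`** for `t = torusChart(α, 1) = d(α, ·, σα⁻¹)`, `μ` Haar on `N(L⁺_v)` and EVERY `F : N → ℂ`: `u ↦ t⁻¹ u t` is a homeomorphism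
(inverse `u ↦ t u t⁻¹`), hence a measurable embedding (Mathlib `MeasurableEmbedding.integral_map`, no measurability of `F` needed), and `μ.map (t⁻¹ · t) = Δ_B(t) • μ`,
`Δ_B(t) = ‖α‖²` (★ `map_torusConj_cmBorel_eq_modularCharacter_nnreal_smul`, ★ `modularCharacter_cmBorel_torus`). [cite: WeilBNT1967, Ch. II §5 Prop. 12] [cite: Rogawski1990, §1.10 p. 9] -/
theorem integral_comp_torusConj (α : (LocalRing L v)ˣ) (F : ↥(cmBorelTriple L 3 v).N → ℂ) :
    ∫ u : ↥(cmBorelTriple L 3 v).N, F (HeisRing.torusConj (conjLocal L (IsCMField.complexConj L) v) (F0P3cStCharTSTorusDefs.torusChart L v (α, 1)) u) ∂μ =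
      ((((unitModulusChar (LocalRing L v) α * unitModulusChar (LocalRing L v) α : ℝ≥0)) : ℝ) : ℂ) * ∫ u : ↥(cmBorelTriple L 3 v).N, F u ∂μ := by
  haveI := locallyCompactSpace_cmBorelU L 3 v
  set t : ↥(cmBorelTriple L 3 v).M := F0P3cStCharTSTorusDefs.torusChart L v (α, 1) with ht
  have hd : glDiagonal 3 (LocalRing L v) (F0P3cStCharTSTorusDefs.torusChartEntries L v (α, 1)) = ((t : ↥(unitaryGroupOfForm (conjLocal L (IsCMField.complexConj L) v) (cmLocalForm L 3 v))) : GL (Fin 3) (LocalRing L v)) :=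
    (F0P3cStCharTSTorusDefs.coe_torusChart L v (α, 1)).symm
  have hd0 : F0P3cStCharTSTorusDefs.torusChartEntries L v (α, 1) 0 = α := rfl
  -- the homeomorphism `u ↦ t⁻¹ u t`
  let e : ↥(cmBorelTriple L 3 v).N ≃ₜ ↥(cmBorelTriple L 3 v).N :=
    { toFun := HeisRing.torusConj (conjLocal L (IsCMField.complexConj L) v) t
      invFun := HeisRing.torusConj (conjLocal L (IsCMField.complexConj L) v) t⁻¹
      left_inv := fun u => by
        apply Subtype.ext
        rw [HeisRing.coe_torusConj, HeisRing.coe_torusConj, Subgroup.coe_inv, inv_inv]; group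
      right_inv := fun u => by
        apply Subtype.ext
        rw [HeisRing.coe_torusConj, HeisRing.coe_torusConj, Subgroup.coe_inv, inv_inv]; group
      continuous_toFun := HeisRing.continuous_torusConj (conjLocal L (IsCMField.complexConj L) v) t
      continuous_invFun := HeisRing.continuous_torusConj (conjLocal L (IsCMField.complexConj L) v) t⁻¹ }
  have he : (e : ↥(cmBorelTriple L 3 v).N → ↥(cmBorelTriple L 3 v).N) = HeisRing.torusConj (conjLocal L (IsCMField.complexConj L) v) t := rfl
  have hmap := map_torusConj_cmBorel_eq_modularCharacter_nnreal_smul L v t μ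
  have hκ : (Measure.modularCharacter (⟨(t : ↥(unitaryGroupOfForm (conjLocal L (IsCMField.complexConj L) v) (cmLocalForm L 3 v))), torusU_le_borelU _ _ t.2⟩ : ↥(cmBorelTriple L 3 v).P) : ℝ≥0) =
      unitModulusChar (LocalRing L v) α * unitModulusChar (LocalRing L v) α := by
    rw [F0P2oBorelTorusModulus.modularCharacter_cmBorel_torus L v t hd, hd0]
  have h := e.measurableEmbedding.integral_map (μ := μ) F
  rw [he, hmap, integral_smul_nnreal_measure, hκ] at h
  rw [← h, NNReal.smul_def, Complex.real_smul]

/-! ## §2 The entry, the height and the weight under torus conjugation -/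

omit [MeasurableSpace ↥(cmBorelTriple L 3 v).N] [BorelSpace ↥(cmBorelTriple L 3 v).N] in
/-- **`(t⁻¹ u t)₀₂ = α⁻¹ · u₀₂ · (σα)⁻¹`** for `t = torusChart(α, 1)` (★ `entry_torusConj`; `d₀ = α`, `d₂ = (σα)⁻¹`). [cite: Rogawski1990, §1.10 p. 9] -/
theorem entry_torusConj_torusChart (α : (LocalRing L v)ˣ) (u : ↥(cmBorelTriple L 3 v).N) :
    ((((HeisRing.torusConj (conjLocal L (IsCMField.complexConj L) v) (F0P3cStCharTSTorusDefs.torusChart L v (α, 1)) u : ↥(cmBorelTriple L 3 v).N) :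
        ↥(unitaryGroupOfForm (conjLocal L (IsCMField.complexConj L) v) (cmLocalForm L 3 v))) : GL (Fin 3) (LocalRing L v)) : Matrix (Fin 3) (Fin 3) (LocalRing L v)) 0 2 =
      ((α⁻¹ : (LocalRing L v)ˣ) : LocalRing L v) * (((((u : ↥(unitaryGroupOfForm (conjLocal L (IsCMField.complexConj L) v) (cmLocalForm L 3 v)))) : GL (Fin 3) (LocalRing L v)) : Matrix (Fin 3) (Fin 3) (LocalRing L v)) 0 2) *
        (((Units.map (conjLocal L (IsCMField.complexConj L) v : LocalRing L v →* LocalRing L v) α)⁻¹ : (LocalRing L v)ˣ) : LocalRing L v) := by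
  have hd : glDiagonal 3 (LocalRing L v) (F0P3cStCharTSTorusDefs.torusChartEntries L v (α, 1)) =
      (((F0P3cStCharTSTorusDefs.torusChart L v (α, 1) : ↥(cmBorelTriple L 3 v).M) : ↥(unitaryGroupOfForm (conjLocal L (IsCMField.complexConj L) v) (cmLocalForm L 3 v))) : GL (Fin 3) (LocalRing L v)) :=
    (F0P3cStCharTSTorusDefs.coe_torusChart L v (α, 1)).symm
  rw [F0P3cStCharTSKeys3TorusConjBall.entry_torusConj (conjLocal L (IsCMField.complexConj L) v) _ hd u 0 2]
  rfl

omit [MeasurableSpace ↥(cmBorelTriple L 3 v).N] [BorelSpace ↥(cmBorelTriple L 3 v).N] in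
/-- **`m(t⁻¹ u t) = (‖α‖·‖α‖)⁻¹ · m(u)`** for `t = torusChart(α, 1)` — ★ `height_torusConj` read in `ℝ`. [cite: Rogawski1990, §1.10 p. 9] [cite: WeilBNT1967, Ch. I §2] -/
theorem height_torusConj_torusChart (α : (LocalRing L v)ˣ) (u : ↥(cmBorelTriple L 3 v).N) :
    (((∏ w' : PlacesOver L v, normAbs (w'.1.adicCompletion L) ((((((HeisRing.torusConj (conjLocal L (IsCMField.complexConj L) v) (F0P3cStCharTSTorusDefs.torusChart L v (α, 1)) u : ↥(cmBorelTriple L 3 v).N) :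
        ↥(unitaryGroupOfForm (conjLocal L (IsCMField.complexConj L) v) (cmLocalForm L 3 v))) : GL (Fin 3) (LocalRing L v)) : Matrix (Fin 3) (Fin 3) (LocalRing L v)) 0 2) w')) : ℝ≥0) : ℝ) =
      ((((unitModulusChar (LocalRing L v) α : ℝ≥0) : ℝ) * ((unitModulusChar (LocalRing L v) α : ℝ≥0) : ℝ))⁻¹) *
        (((∏ w' : PlacesOver L v, normAbs (w'.1.adicCompletion L) ((((((u : ↥(unitaryGroupOfForm (conjLocal L (IsCMField.complexConj L) v) (cmLocalForm L 3 v)))) : GL (Fin 3) (LocalRing L v)) : Matrix (Fin 3) (Fin 3) (LocalRing L v)) 0 2) w')) : ℝ≥0) : ℝ) := by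
  letI : MeasurableSpace (LocalRing L v) := borel _
  haveI : BorelSpace (LocalRing L v) := ⟨rfl⟩
  have hd : glDiagonal 3 (LocalRing L v) (F0P3cStCharTSTorusDefs.torusChartEntries L v (α, 1)) =
      (((F0P3cStCharTSTorusDefs.torusChart L v (α, 1) : ↥(cmBorelTriple L 3 v).M) : ↥(unitaryGroupOfForm (conjLocal L (IsCMField.complexConj L) v) (cmLocalForm L 3 v))) : GL (Fin 3) (LocalRing L v)) :=
    (F0P3cStCharTSTorusDefs.coe_torusChart L v (α, 1)).symm
  have hd0 : F0P3cStCharTSTorusDefs.torusChartEntries L v (α, 1) 0 = α := rfl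
  rw [K2E3IntertwiningIntegralMajorant.height_torusConj L v _ hd u, hd0, NNReal.coe_mul, NNReal.coe_mul, NNReal.coe_inv, mul_inv]
  rfl

open Classical in
omit [MeasurableSpace ↥(cmBorelTriple L 3 v).N] [BorelSpace ↥(cmBorelTriple L 3 v).N] in
set_option maxHeartbeats 1600000 in
/-- **THE WEIGHT DILATES BY `χ₁(α σα)·‖α‖²`: `c(t⁻¹ u t) = χ₁(α·σα) · ‖α‖·‖α‖ · c(u)`**, `c(u) = χ₁(σ b)⁻¹ χ₂(−1) ‖b‖⁻¹` (`b = u₀₂` a unit; `0` otherwise).  Indeed `b′ = (t⁻¹ut)₀₂ = α⁻¹ b (σα)⁻¹`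
is a unit iff `b` is; `σ b′ = (σα)⁻¹ σ(b) α⁻¹` (`σσ = 1`, ★ `conjLocal_conjLocal_cm`) gives `χ₁(σb′)⁻¹ = χ₁(α σα)·χ₁(σb)⁻¹`, and `‖b′‖⁻¹ = ‖α‖·‖σα‖·‖b‖⁻¹ = ‖α‖²‖b‖⁻¹` (`‖σα‖ = ‖α‖`: the torus
relation `‖d₂‖ = ‖d₀‖⁻¹` ★ `HeisRing.distribHaarChar_torus`). [cite: Casselman1995, §6.4 p. 63] [cite: Keys1984, §3–§4] [cite: Rogawski1990, §1.10 p. 9] -/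
theorem weight_torusConj_torusChart (χ₁ : (LocalRing L v)ˣ →* ℂˣ) (χ₂ : ↥(normOneUnits (conjLocal L (IsCMField.complexConj L) v)) →* ℂˣ)
    (α : (LocalRing L v)ˣ) (u : ↥(cmBorelTriple L 3 v).N) :
    (if hb : IsUnit (((((HeisRing.torusConj (conjLocal L (IsCMField.complexConj L) v) (F0P3cStCharTSTorusDefs.torusChart L v (α, 1)) u : ↥(cmBorelTriple L 3 v).N) :
        ↥(unitaryGroupOfForm (conjLocal L (IsCMField.complexConj L) v) (cmLocalForm L 3 v))) : GL (Fin 3) (LocalRing L v)) : Matrix (Fin 3) (Fin 3) (LocalRing L v)) 0 2) then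
        ((((χ₁ (Units.map (conjLocal L (IsCMField.complexConj L) v : LocalRing L v →* LocalRing L v) hb.unit))⁻¹ : ℂˣ) : ℂ) *
          ((χ₂ ⟨-1, F0P3cStCharTSBigCellFactorisation.neg_one_mem_normOneUnits (conjLocal L (IsCMField.complexConj L) v)⟩ : ℂˣ) : ℂ) *
          ((((unitModulusChar (LocalRing L v) hb.unit)⁻¹ : ℝ≥0) : ℝ) : ℂ))
      else 0) =
      ((χ₁ (α * Units.map (conjLocal L (IsCMField.complexConj L) v : LocalRing L v →* LocalRing L v) α) : ℂˣ) : ℂ) *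
        ((((unitModulusChar (LocalRing L v) α * unitModulusChar (LocalRing L v) α : ℝ≥0)) : ℝ) : ℂ) *
      (if hb : IsUnit (((((u : ↥(unitaryGroupOfForm (conjLocal L (IsCMField.complexConj L) v) (cmLocalForm L 3 v)))) : GL (Fin 3) (LocalRing L v)) : Matrix (Fin 3) (Fin 3) (LocalRing L v)) 0 2) then
        ((((χ₁ (Units.map (conjLocal L (IsCMField.complexConj L) v : LocalRing L v →* LocalRing L v) hb.unit))⁻¹ : ℂˣ) : ℂ) *
          ((χ₂ ⟨-1, F0P3cStCharTSBigCellFactorisation.neg_one_mem_normOneUnits (conjLocal L (IsCMField.complexConj L) v)⟩ : ℂˣ) : ℂ) *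
          ((((unitModulusChar (LocalRing L v) hb.unit)⁻¹ : ℝ≥0) : ℝ) : ℂ))
      else 0) := by
  letI : MeasurableSpace (LocalRing L v) := borel _
  haveI : BorelSpace (LocalRing L v) := ⟨rfl⟩
  have hσσ := conjLocal_conjLocal_cm L v
  have hent := entry_torusConj_torusChart L v α u
  -- `‖σα‖ = ‖α‖` from the torus relation `‖d₂‖ = ‖d₀‖⁻¹`, `d₂ = (σα)⁻¹`
  have hd : glDiagonal 3 (LocalRing L v) (F0P3cStCharTSTorusDefs.torusChartEntries L v (α, 1)) =
      (((F0P3cStCharTSTorusDefs.torusChart L v (α, 1) : ↥(cmBorelTriple L 3 v).M) : ↥(unitaryGroupOfForm (conjLocal L (IsCMField.complexConj L) v) (cmLocalForm L 3 v))) : GL (Fin 3) (LocalRing L v)) :=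
    (F0P3cStCharTSTorusDefs.coe_torusChart L v (α, 1)).symm
  have hd0 : F0P3cStCharTSTorusDefs.torusChartEntries L v (α, 1) 0 = α := rfl
  have hd2 : F0P3cStCharTSTorusDefs.torusChartEntries L v (α, 1) 2 = (Units.map (conjLocal L (IsCMField.complexConj L) v : LocalRing L v →* LocalRing L v) α)⁻¹ := rfl
  have hσα : unitModulusChar (LocalRing L v) (Units.map (conjLocal L (IsCMField.complexConj L) v : LocalRing L v →* LocalRing L v) α) = unitModulusChar (LocalRing L v) α := by
    have h := (HeisRing.distribHaarChar_torus (conjLocal L (IsCMField.complexConj L) v) hσσ (continuous_conjLocal L (IsCMField.complexConj L) v) (cmLocalForm_eq_over L 3 v) _ hd).2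
    rw [hd0, hd2, map_inv, inv_inj] at h
    exact h
  by_cases hb : IsUnit (((((u : ↥(unitaryGroupOfForm (conjLocal L (IsCMField.complexConj L) v) (cmLocalForm L 3 v)))) : GL (Fin 3) (LocalRing L v)) : Matrix (Fin 3) (Fin 3) (LocalRing L v)) 0 2)
  · -- `b′` is the unit `α⁻¹ b (σα)⁻¹`
    have hb' : IsUnit (((((HeisRing.torusConj (conjLocal L (IsCMField.complexConj L) v) (F0P3cStCharTSTorusDefs.torusChart L v (α, 1)) u : ↥(cmBorelTriple L 3 v).N) :
        ↥(unitaryGroupOfForm (conjLocal L (IsCMField.complexConj L) v) (cmLocalForm L 3 v))) : GL (Fin 3) (LocalRing L v)) : Matrix (Fin 3) (Fin 3) (LocalRing L v)) 0 2) := by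
      rw [hent, ← hb.unit_spec]
      exact ((α⁻¹).isUnit.mul hb.unit.isUnit).mul (Units.isUnit _)
    have hunit : hb'.unit = α⁻¹ * hb.unit * (Units.map (conjLocal L (IsCMField.complexConj L) v : LocalRing L v →* LocalRing L v) α)⁻¹ :=
      Units.ext (by rw [IsUnit.unit_spec, hent, Units.val_mul, Units.val_mul, IsUnit.unit_spec])
    rw [dif_pos hb', dif_pos hb, hunit]
    generalize hb.unit = B
    -- `χ₁(σ b′)⁻¹ = χ₁(α σα) χ₁(σ b)⁻¹` in `ℂˣ`
    have hσσα : Units.map (conjLocal L (IsCMField.complexConj L) v : LocalRing L v →* LocalRing L v)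
        (Units.map (conjLocal L (IsCMField.complexConj L) v : LocalRing L v →* LocalRing L v) α) = α :=
      Units.ext (by rw [Units.coe_map, Units.coe_map, MonoidHom.coe_coe]; exact hσσ _)
    have hχ : (χ₁ (Units.map (conjLocal L (IsCMField.complexConj L) v : LocalRing L v →* LocalRing L v)
        (α⁻¹ * B * (Units.map (conjLocal L (IsCMField.complexConj L) v : LocalRing L v →* LocalRing L v) α)⁻¹)))⁻¹ =
        χ₁ (α * Units.map (conjLocal L (IsCMField.complexConj L) v : LocalRing L v →* LocalRing L v) α) *
          (χ₁ (Units.map (conjLocal L (IsCMField.complexConj L) v : LocalRing L v →* LocalRing L v) B))⁻¹ := by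
      rw [map_mul, map_mul, map_inv, map_inv, hσσα, map_mul, map_mul, map_inv, map_inv, mul_inv, mul_inv, inv_inv, inv_inv, map_mul,
        mul_comm (χ₁ α) _, mul_right_comm]
    -- `‖b′‖⁻¹ = ‖α‖² ‖b‖⁻¹` in `ℝ≥0`
    have hn : (unitModulusChar (LocalRing L v) (α⁻¹ * B * (Units.map (conjLocal L (IsCMField.complexConj L) v : LocalRing L v →* LocalRing L v) α)⁻¹))⁻¹ =
        unitModulusChar (LocalRing L v) α * unitModulusChar (LocalRing L v) α * (unitModulusChar (LocalRing L v) B)⁻¹ := by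
      rw [map_mul, map_mul, map_inv, map_inv, hσα, mul_inv, mul_inv, inv_inv, mul_right_comm]
    rw [hχ, hn]
    push_cast
    ring
  · have hb' : ¬ IsUnit (((((HeisRing.torusConj (conjLocal L (IsCMField.complexConj L) v) (F0P3cStCharTSTorusDefs.torusChart L v (α, 1)) u : ↥(cmBorelTriple L 3 v).N) :
        ↥(unitaryGroupOfForm (conjLocal L (IsCMField.complexConj L) v) (cmLocalForm L 3 v))) : GL (Fin 3) (LocalRing L v)) : Matrix (Fin 3) (Fin 3) (LocalRing L v)) 0 2) := by
      intro h
      apply hb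
      rw [hent] at h
      have h2 : IsUnit (((α : (LocalRing L v)ˣ) : LocalRing L v) *
          (((α⁻¹ : (LocalRing L v)ˣ) : LocalRing L v) * (((((u : ↥(unitaryGroupOfForm (conjLocal L (IsCMField.complexConj L) v) (cmLocalForm L 3 v)))) : GL (Fin 3) (LocalRing L v)) : Matrix (Fin 3) (Fin 3) (LocalRing L v)) 0 2) *
            (((Units.map (conjLocal L (IsCMField.complexConj L) v : LocalRing L v →* LocalRing L v) α)⁻¹ : (LocalRing L v)ˣ) : LocalRing L v)) *
          ((Units.map (conjLocal L (IsCMField.complexConj L) v : LocalRing L v →* LocalRing L v) α : (LocalRing L v)ˣ) : LocalRing L v)) :=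
        (α.isUnit.mul h).mul (Units.isUnit _)
      have e : ((α : (LocalRing L v)ˣ) : LocalRing L v) *
          (((α⁻¹ : (LocalRing L v)ˣ) : LocalRing L v) * (((((u : ↥(unitaryGroupOfForm (conjLocal L (IsCMField.complexConj L) v) (cmLocalForm L 3 v)))) : GL (Fin 3) (LocalRing L v)) : Matrix (Fin 3) (Fin 3) (LocalRing L v)) 0 2) *
            (((Units.map (conjLocal L (IsCMField.complexConj L) v : LocalRing L v →* LocalRing L v) α)⁻¹ : (LocalRing L v)ˣ) : LocalRing L v)) *
          ((Units.map (conjLocal L (IsCMField.complexConj L) v : LocalRing L v →* LocalRing L v) α : (LocalRing L v)ˣ) : LocalRing L v) =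
          (((((u : ↥(unitaryGroupOfForm (conjLocal L (IsCMField.complexConj L) v) (cmLocalForm L 3 v)))) : GL (Fin 3) (LocalRing L v)) : Matrix (Fin 3) (Fin 3) (LocalRing L v)) 0 2) := by
        rw [← mul_assoc, ← mul_assoc, Units.mul_inv, one_mul, mul_assoc, Units.inv_mul, mul_one]
      rwa [e] at h2
    rw [dif_neg hb', dif_neg hb, mul_zero]

/-! ## §3 The two-step recursion of the weight shell integrals -/

open Classical in
set_option maxHeartbeats 1600000 in
/-- **`∫_{S_{j+2}} c dμ = χ₁(α·σα) · ∫_{S_j} c dμ`** for the shells `S_j = {m = (‖α‖⁻¹)^j}` of ANY unit `α` (e.g. a uniformiser, `‖α‖ < 1`), `μ` Haar on `N(L⁺_v)`, and the weight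
`c(u) = χ₁(σ u₀₂)⁻¹ χ₂(−1) ‖u₀₂‖⁻¹` (`χ₁, χ₂` arbitrary).  By §1 `‖α‖²·∫_{S_{j+2}} c = ∫ 𝟙_{S_{j+2}}(t⁻¹ut)·c(t⁻¹ut) dμ(u)`; `t⁻¹ut ∈ S_{j+2} ↔ u ∈ S_j` (§2, `m(t⁻¹ut) = ‖α‖⁻²m(u)`) and
`c(t⁻¹ut) = χ₁(ασα)‖α‖²c(u)` (§2); cancel `‖α‖² ≠ 0`.  DESIGN-B (B5): with ★ (B4) only the base shells `j = 0, 1` remain to be evaluated. [cite: Casselman1995, §6.4 p. 63] [cite: Keys1984, §3–§4] [cite: WeilBNT1967, Ch. II §5 Prop. 12] -/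
theorem setIntegral_weight_shell_succ_succ (χ₁ : (LocalRing L v)ˣ →* ℂˣ) (χ₂ : ↥(normOneUnits (conjLocal L (IsCMField.complexConj L) v)) →* ℂˣ)
    (α : (LocalRing L v)ˣ) (j : ℕ) :
    ∫ u in {u : ↥(cmBorelTriple L 3 v).N | (((∏ w' : PlacesOver L v, normAbs (w'.1.adicCompletion L) ((((((u : ↥(unitaryGroupOfForm (conjLocal L (IsCMField.complexConj L) v) (cmLocalForm L 3 v)))) : GL (Fin 3) (LocalRing L v)) : Matrix (Fin 3) (Fin 3) (LocalRing L v)) 0 2) w')) : ℝ≥0) : ℝ) = (((unitModulusChar (LocalRing L v) α : ℝ≥0) : ℝ)⁻¹) ^ (j + 2)},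
        (if hb : IsUnit (((((u : ↥(unitaryGroupOfForm (conjLocal L (IsCMField.complexConj L) v) (cmLocalForm L 3 v)))) : GL (Fin 3) (LocalRing L v)) : Matrix (Fin 3) (Fin 3) (LocalRing L v)) 0 2) then
          ((((χ₁ (Units.map (conjLocal L (IsCMField.complexConj L) v : LocalRing L v →* LocalRing L v) hb.unit))⁻¹ : ℂˣ) : ℂ) *
            ((χ₂ ⟨-1, F0P3cStCharTSBigCellFactorisation.neg_one_mem_normOneUnits (conjLocal L (IsCMField.complexConj L) v)⟩ : ℂˣ) : ℂ) *
            ((((unitModulusChar (LocalRing L v) hb.unit)⁻¹ : ℝ≥0) : ℝ) : ℂ))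
        else 0) ∂μ =
      ((χ₁ (α * Units.map (conjLocal L (IsCMField.complexConj L) v : LocalRing L v →* LocalRing L v) α) : ℂˣ) : ℂ) *
      ∫ u in {u : ↥(cmBorelTriple L 3 v).N | (((∏ w' : PlacesOver L v, normAbs (w'.1.adicCompletion L) ((((((u : ↥(unitaryGroupOfForm (conjLocal L (IsCMField.complexConj L) v) (cmLocalForm L 3 v)))) : GL (Fin 3) (LocalRing L v)) : Matrix (Fin 3) (Fin 3) (LocalRing L v)) 0 2) w')) : ℝ≥0) : ℝ) = (((unitModulusChar (LocalRing L v) α : ℝ≥0) : ℝ)⁻¹) ^ j},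
        (if hb : IsUnit (((((u : ↥(unitaryGroupOfForm (conjLocal L (IsCMField.complexConj L) v) (cmLocalForm L 3 v)))) : GL (Fin 3) (LocalRing L v)) : Matrix (Fin 3) (Fin 3) (LocalRing L v)) 0 2) then
          ((((χ₁ (Units.map (conjLocal L (IsCMField.complexConj L) v : LocalRing L v →* LocalRing L v) hb.unit))⁻¹ : ℂˣ) : ℂ) *
            ((χ₂ ⟨-1, F0P3cStCharTSBigCellFactorisation.neg_one_mem_normOneUnits (conjLocal L (IsCMField.complexConj L) v)⟩ : ℂˣ) : ℂ) *
            ((((unitModulusChar (LocalRing L v) hb.unit)⁻¹ : ℝ≥0) : ℝ) : ℂ))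
        else 0) ∂μ := by
  set a : ℝ := ((unitModulusChar (LocalRing L v) α : ℝ≥0) : ℝ) with ha
  have ha0 : 0 < a := NNReal.coe_pos.2 distribHaarChar_pos
  have hm : Measurable fun u : ↥(cmBorelTriple L 3 v).N => (((∏ w' : PlacesOver L v, normAbs (w'.1.adicCompletion L) ((((((u : ↥(unitaryGroupOfForm (conjLocal L (IsCMField.complexConj L) v) (cmLocalForm L 3 v)))) : GL (Fin 3) (LocalRing L v)) : Matrix (Fin 3) (Fin 3) (LocalRing L v)) 0 2) w')) : ℝ≥0) : ℝ) :=
    (F0P3cStCharTSKeys3AnnulusDock.continuous_norm_entry L v).measurable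
  set S : ℕ → Set ↥(cmBorelTriple L 3 v).N := fun k => {u | (((∏ w' : PlacesOver L v, normAbs (w'.1.adicCompletion L) ((((((u : ↥(unitaryGroupOfForm (conjLocal L (IsCMField.complexConj L) v) (cmLocalForm L 3 v)))) : GL (Fin 3) (LocalRing L v)) : Matrix (Fin 3) (Fin 3) (LocalRing L v)) 0 2) w')) : ℝ≥0) : ℝ) = (a⁻¹) ^ k} with hS
  have hSm : ∀ k, MeasurableSet (S k) := fun k => measurableSet_eq_fun hm measurable_const
  set c : ↥(cmBorelTriple L 3 v).N → ℂ := fun u =>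
    if hb : IsUnit (((((u : ↥(unitaryGroupOfForm (conjLocal L (IsCMField.complexConj L) v) (cmLocalForm L 3 v)))) : GL (Fin 3) (LocalRing L v)) : Matrix (Fin 3) (Fin 3) (LocalRing L v)) 0 2) then
      ((((χ₁ (Units.map (conjLocal L (IsCMField.complexConj L) v : LocalRing L v →* LocalRing L v) hb.unit))⁻¹ : ℂˣ) : ℂ) *
        ((χ₂ ⟨-1, F0P3cStCharTSBigCellFactorisation.neg_one_mem_normOneUnits (conjLocal L (IsCMField.complexConj L) v)⟩ : ℂˣ) : ℂ) *
        ((((unitModulusChar (LocalRing L v) hb.unit)⁻¹ : ℝ≥0) : ℝ) : ℂ))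
    else 0 with hc
  -- the shell indicator pulls back: `𝟙_{S_{j+2}}(t⁻¹ut) c(t⁻¹ut) = 𝟙_{S_j}(u) · ρ a² c(u)`
  have hpull : (fun u => (S (j + 2)).indicator c (HeisRing.torusConj (conjLocal L (IsCMField.complexConj L) v) (F0P3cStCharTSTorusDefs.torusChart L v (α, 1)) u)) =
      fun u => (S j).indicator (fun u' => (((χ₁ (α * Units.map (conjLocal L (IsCMField.complexConj L) v : LocalRing L v →* LocalRing L v) α) : ℂˣ) : ℂ) *
        ((((unitModulusChar (LocalRing L v) α * unitModulusChar (LocalRing L v) α : ℝ≥0)) : ℝ) : ℂ)) * c u') u := by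
    funext u
    have hmem : HeisRing.torusConj (conjLocal L (IsCMField.complexConj L) v) (F0P3cStCharTSTorusDefs.torusChart L v (α, 1)) u ∈ S (j + 2) ↔ u ∈ S j := by
      simp only [hS, Set.mem_setOf_eq]
      rw [height_torusConj_torusChart L v α u, ← ha]
      have e : (a⁻¹) ^ (j + 2) = (a * a)⁻¹ * (a⁻¹) ^ j := by rw [pow_add, mul_inv, inv_pow, inv_pow]; ring
      rw [e]
      exact ⟨fun h => mul_left_cancel₀ (inv_ne_zero (mul_pos ha0 ha0).ne') h, fun h => by rw [h]⟩
    by_cases hu : u ∈ S j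
    · rw [Set.indicator_of_mem (hmem.2 hu), Set.indicator_of_mem hu, hc]
      exact weight_torusConj_torusChart L v χ₁ χ₂ α u
    · rw [Set.indicator_of_notMem (fun h => hu (hmem.1 h)), Set.indicator_of_notMem hu]
  have hcv := integral_comp_torusConj L v μ α ((S (j + 2)).indicator c)
  rw [hpull, integral_indicator (hSm (j + 2)), integral_indicator (hSm j), integral_const_mul] at hcv
  -- cancel `a² ≠ 0`
  have ha2 : ((((unitModulusChar (LocalRing L v) α * unitModulusChar (LocalRing L v) α : ℝ≥0)) : ℝ) : ℂ) ≠ 0 := by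
    rw [NNReal.coe_mul, ← ha]; exact_mod_cast (mul_pos ha0 ha0).ne'
  have key : ((((unitModulusChar (LocalRing L v) α * unitModulusChar (LocalRing L v) α : ℝ≥0)) : ℝ) : ℂ) * ∫ u in S (j + 2), c u ∂μ =
      ((((unitModulusChar (LocalRing L v) α * unitModulusChar (LocalRing L v) α : ℝ≥0)) : ℝ) : ℂ) *
        ((((χ₁ (α * Units.map (conjLocal L (IsCMField.complexConj L) v : LocalRing L v →* LocalRing L v) α) : ℂˣ) : ℂ)) * ∫ u in S j, c u ∂μ) := by
    rw [← hcv]; ring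
  exact mul_left_cancel₀ ha2 key

end Summit.HodgeConjecture.HodgeConjecture.Cruxes.H413.K2E3WeightShellDilation

end
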